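import Mathlib
import HarnessLib

/-!
# Difference-derivation calculus on power-sum products
(crux `OrbitRestorationQP`, stmt-ValiantsHypothesis-18293 — lane SML: the column-set-multilinear `ΣΠΣ` stratum of A_∞)

For pairs of variables `(a i, b i)`, `i : Fin j`, the iterated DIFFERENCE DERIVATIVE of a polynomial `q` is written
def-free as

  `List.foldl (fun q i => pderiv (a i) q - pderiv (b i) q) q (List.finRange j)`

(`Δ_{a,b} q = Π_i (∂_{a i} - ∂_{b i}) q`; the operators commute, the fold applies pair `0` innermost).  This file proves
the calculus the narrowness lemma of the set-multilinear stratum needs (blueprint `SML-STRATUM-BLUEPRINT.md` on the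
crux item):

* recursion in `j`, additivity / homogeneity / sums, multiplicativity by factors the derivations kill, transport under
  injective renamings, and the expansion `Δ_{a,b} q = Σ_{ε : Fin j → Bool} (-1)^{#ε} ∂_{mix a b ε} q` into iterated
  partial derivatives;
* a derivation on a multiset product, `(∂_a - ∂_b) p_k = k (y_a^{k-1} - y_b^{k-1})`, hence the one-step formula on a
  power-sum product `Π_{k ∈ μ} p_k`;
* **(N1)** if the `2j` variables are distinct and `μ` has fewer than `j` parts `≥ 2`, then `Δ_{a,b} (Π_{k∈μ} p_k) = 0`
  (unit parts are invisible: `(∂_a - ∂_b) p_1 = 0`; a factor hit twice dies: disjoint variables).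
[folklore]
-/

set_option linter.dupNamespace false

namespace Summit.ValiantsHypothesis.ValiantsHypothesis.Theorems.SmlDeltaCalculus

open MvPolynomial

variable {σ : Type*}

/-! ### The fold: recursion, linearity, multiplicativity, transport -/

/-- Recursion: peeling pair `0` (applied innermost). [folklore] -/
theorem deltaFold_succ {j : ℕ} (a b : Fin (j + 1) → σ) (q : MvPolynomial σ ℂ) :
    List.foldl (fun q i => pderiv (a i) q - pderiv (b i) q) q (List.finRange (j + 1)) =
      List.foldl (fun q i => pderiv (a i.succ) q - pderiv (b i.succ) q)
        (pderiv (a 0) q - pderiv (b 0) q) (List.finRange j) := by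
  rw [List.finRange_succ, List.foldl_cons, List.foldl_map]

/-- The fold along any list of pair indices is additive. [folklore] -/
theorem deltaFoldList_add {ι : Type*} (a b : ι → σ) :
    ∀ (l : List ι) (q₁ q₂ : MvPolynomial σ ℂ),
      List.foldl (fun q i => pderiv (a i) q - pderiv (b i) q) (q₁ + q₂) l =
        List.foldl (fun q i => pderiv (a i) q - pderiv (b i) q) q₁ l +
          List.foldl (fun q i => pderiv (a i) q - pderiv (b i) q) q₂ l := by
  intro l
  induction l with
  | nil => intro q₁ q₂; rfl
  | cons i l ih =>
    intro q₁ q₂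
    simp only [List.foldl_cons]
    rw [← ih]
    congr 1
    simp only [map_add]
    ring

/-- The fold along any list of pair indices commutes with scalars. [folklore] -/
theorem deltaFoldList_smul {ι : Type*} (a b : ι → σ) :
    ∀ (l : List ι) (c : ℂ) (q : MvPolynomial σ ℂ),
      List.foldl (fun q i => pderiv (a i) q - pderiv (b i) q) (c • q) l =
        c • List.foldl (fun q i => pderiv (a i) q - pderiv (b i) q) q l := by
  intro l
  induction l with
  | nil => intro c q; rfl
  | cons i l ih =>
    intro c q
    simp only [List.foldl_cons]
    rw [← ih]
    congr 1
    rw [(pderiv (a i)).map_smul, (pderiv (b i)).map_smul, smul_sub]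

/-- The fold kills `0`. [folklore] -/
theorem deltaFoldList_zero {ι : Type*} (a b : ι → σ) :
    ∀ (l : List ι), List.foldl (fun q i => pderiv (a i) q - pderiv (b i) q) (0 : MvPolynomial σ ℂ) l = 0 := by
  intro l
  induction l with
  | nil => rfl
  | cons i l ih => simp only [List.foldl_cons, map_zero, sub_zero]; exact ih

/-- The fold commutes with finite sums. [folklore] -/
theorem deltaFoldList_sum {ι κ : Type*} (a b : ι → σ) (l : List ι) (s : Finset κ)
    (q : κ → MvPolynomial σ ℂ) :
    List.foldl (fun q i => pderiv (a i) q - pderiv (b i) q) (∑ x ∈ s, q x) l =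
      ∑ x ∈ s, List.foldl (fun q i => pderiv (a i) q - pderiv (b i) q) (q x) l := by
  classical
  induction s using Finset.induction_on with
  | empty => simp only [Finset.sum_empty]; exact deltaFoldList_zero a b l
  | insert x s hx ih => rw [Finset.sum_insert hx, Finset.sum_insert hx, deltaFoldList_add, ih]

/-- The fold commutes with multiset sums. [folklore] -/
theorem deltaFoldList_multiset_sum {ι : Type*} (a b : ι → σ) (l : List ι) :
    ∀ (M : Multiset (MvPolynomial σ ℂ)),
      List.foldl (fun q i => pderiv (a i) q - pderiv (b i) q) M.sum l =
        (M.map fun q => List.foldl (fun q i => pderiv (a i) q - pderiv (b i) q) q l).sum := by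
  intro M
  induction M using Multiset.induction_on with
  | empty => simp only [Multiset.sum_zero, Multiset.map_zero]; exact deltaFoldList_zero a b l
  | cons q M ih => rw [Multiset.sum_cons, Multiset.map_cons, Multiset.sum_cons, deltaFoldList_add, ih]

/-- Multiplicativity by a factor killed by all the partial derivatives in play. [folklore] -/
theorem deltaFoldList_mul_of_killed {ι : Type*} (a b : ι → σ) (g : MvPolynomial σ ℂ)
    (hga : ∀ i, pderiv (a i) g = 0) (hgb : ∀ i, pderiv (b i) g = 0) :
    ∀ (l : List ι) (q : MvPolynomial σ ℂ),
      List.foldl (fun q i => pderiv (a i) q - pderiv (b i) q) (g * q) l =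
        g * List.foldl (fun q i => pderiv (a i) q - pderiv (b i) q) q l := by
  intro l
  induction l with
  | nil => intro q; rfl
  | cons i l ih =>
    intro q
    simp only [List.foldl_cons]
    rw [← ih]
    congr 1
    rw [pderiv_mul, pderiv_mul, hga, hgb]
    ring

/-- Transport under an injective renaming of the variables. [folklore] -/
theorem rename_deltaFoldList {ι τ : Type*} (f : σ → τ) (hf : Function.Injective f)
    (a b : ι → σ) :
    ∀ (l : List ι) (q : MvPolynomial σ ℂ),
      rename f (List.foldl (fun q i => pderiv (a i) q - pderiv (b i) q) q l) =
        List.foldl (fun q i => pderiv (f (a i)) q - pderiv (f (b i)) q) (rename f q) l := by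
  intro l
  induction l with
  | nil => intro q; rfl
  | cons i l ih =>
    intro q
    simp only [List.foldl_cons]
    rw [ih, map_sub, ← pderiv_rename hf, ← pderiv_rename hf]

/-- Transport of an iterated partial derivative under an injective renaming. [folklore] -/
theorem rename_pderivFoldList {ι τ : Type*} (f : σ → τ) (hf : Function.Injective f)
    (ρ : ι → σ) :
    ∀ (l : List ι) (q : MvPolynomial σ ℂ),
      rename f (List.foldl (fun q i => pderiv (ρ i) q) q l) =
        List.foldl (fun q i => pderiv (f (ρ i)) q) (rename f q) l := by
  intro l
  induction l with
  | nil => intro q; rfl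
  | cons i l ih =>
    intro q
    simp only [List.foldl_cons]
    rw [ih, ← pderiv_rename hf]

/-- The iterated partial derivative along a list is additive. [folklore] -/
theorem pderivFoldList_add {ι : Type*} (ρ : ι → σ) :
    ∀ (l : List ι) (q₁ q₂ : MvPolynomial σ ℂ),
      List.foldl (fun q i => pderiv (ρ i) q) (q₁ + q₂) l =
        List.foldl (fun q i => pderiv (ρ i) q) q₁ l + List.foldl (fun q i => pderiv (ρ i) q) q₂ l := by
  intro l
  induction l with
  | nil => intro q₁ q₂; rfl
  | cons i l ih => intro q₁ q₂; simp only [List.foldl_cons, map_add]; exact ih _ _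

/-- The iterated partial derivative along a list commutes with negation. [folklore] -/
theorem pderivFoldList_neg {ι : Type*} (ρ : ι → σ) :
    ∀ (l : List ι) (q : MvPolynomial σ ℂ),
      List.foldl (fun q i => pderiv (ρ i) q) (-q) l = -List.foldl (fun q i => pderiv (ρ i) q) q l := by
  intro l
  induction l with
  | nil => intro q; rfl
  | cons i l ih => intro q; simp only [List.foldl_cons, map_neg]; exact ih _

/-- The iterated partial derivative along a list commutes with integer scalars. [folklore] -/
theorem pderivFoldList_zsmul {ι : Type*} (ρ : ι → σ) (l : List ι) (z : ℤ) (q : MvPolynomial σ ℂ) :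
    List.foldl (fun q i => pderiv (ρ i) q) (z • q) l = z • List.foldl (fun q i => pderiv (ρ i) q) q l := by
  have hadd := pderivFoldList_add (σ := σ) ρ l
  have hneg := pderivFoldList_neg (σ := σ) ρ l
  -- the fold is an additive group homomorphism, hence `ℤ`-linear
  let Φ : MvPolynomial σ ℂ →+ MvPolynomial σ ℂ :=
    { toFun := fun q => List.foldl (fun q i => pderiv (ρ i) q) q l
      map_zero' := by
        have h := hadd 0 0
        simp only [add_zero] at h
        -- `Φ 0 = Φ 0 + Φ 0`
        have : List.foldl (fun q i => pderiv (ρ i) q) (0 : MvPolynomial σ ℂ) l +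
            List.foldl (fun q i => pderiv (ρ i) q) (0 : MvPolynomial σ ℂ) l -
            List.foldl (fun q i => pderiv (ρ i) q) (0 : MvPolynomial σ ℂ) l = 0 := by
          rw [← h, sub_self]
        simpa using this
      map_add' := hadd }
  exact map_zsmul Φ z q

/-- **Expansion into iterated partial derivatives**: `Π_i (∂_{a i} - ∂_{b i}) q = Σ_ε (-1)^{#ε} ∂_{mix ε} q`, where
`mix ε` picks `b i` when `ε i` and `a i` otherwise. [folklore] -/
theorem deltaFold_eq_sum_bool :
    ∀ (j : ℕ) (a b : Fin j → σ) (q : MvPolynomial σ ℂ),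
      List.foldl (fun q i => pderiv (a i) q - pderiv (b i) q) q (List.finRange j) =
        ∑ ε : Fin j → Bool, ((-1 : ℤ) ^ (Finset.univ.filter fun i => ε i = true).card) •
          List.foldl (fun q i => pderiv (if ε i then b i else a i) q) q (List.finRange j) := by
  intro j
  induction j with
  | zero =>
    intro a b q
    simp [List.finRange_zero]
  | succ j ih =>
    intro a b q
    rw [deltaFold_succ, ih]
    -- split the sum over `ε : Fin (j+1) → Bool` as `ε = Fin.cons β ε'`
    rw [← (Fin.consEquiv fun _ : Fin (j + 1) => Bool).sum_comp, Fintype.sum_prod_type, Fintype.sum_bool]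
    have hcount : ∀ (β : Bool) (ε' : Fin j → Bool),
        (Finset.univ.filter fun i : Fin (j + 1) =>
            (Fin.consEquiv (fun _ => Bool) (β, ε')) i = true).card =
          (if β then 1 else 0) + (Finset.univ.filter fun i : Fin j => ε' i = true).card := by
      intro β ε'
      simp only [Finset.card_filter, Fin.sum_univ_succ]
      cases β <;> simp [Fin.consEquiv]
    have hfold : ∀ (β : Bool) (ε' : Fin j → Bool) (r : MvPolynomial σ ℂ),
        List.foldl (fun q i => pderiv (if (Fin.consEquiv (fun _ => Bool) (β, ε')) i then b i else a i) q)
            r (List.finRange (j + 1)) =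
          List.foldl (fun q i => pderiv (if ε' i then b i.succ else a i.succ) q)
            (pderiv (if β then b 0 else a 0) r) (List.finRange j) := by
      intro β ε' r
      rw [List.finRange_succ, List.foldl_cons, List.foldl_map]
      congr 1
    simp only [hcount, hfold, if_true, Bool.false_eq_true, if_false, zero_add]
    rw [← Finset.sum_add_distrib]
    refine Finset.sum_congr rfl fun ε' _ => ?_
    rw [sub_eq_add_neg, pderivFoldList_add, pderivFoldList_neg, smul_add, smul_neg, pow_add, pow_one,
      mul_smul, neg_one_zsmul, add_comm]

/-! ### Derivations on power-sum products -/

/-- A derivation on a multiset product: `D (Π_{k∈M} g k) = Σ_{k∈M} D (g k) · Π_{M.erase k} g`. [folklore] -/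
theorem derivation_multiset_prod (D : Derivation ℂ (MvPolynomial σ ℂ) (MvPolynomial σ ℂ))
    (g : ℕ → MvPolynomial σ ℂ) :
    ∀ M : Multiset ℕ, D ((M.map g).prod) = (M.map fun k => D (g k) * ((M.erase k).map g).prod).sum := by
  intro M
  induction M using Multiset.induction_on with
  | empty => simp
  | cons k₀ M ih =>
    rw [Multiset.map_cons, Multiset.prod_cons, Derivation.leibniz, ih, Multiset.map_cons,
      Multiset.sum_cons, Multiset.erase_cons_head, smul_eq_mul, smul_eq_mul]
    have hterm : ∀ k ∈ M, D (g k) * (((k₀ ::ₘ M).erase k).map g).prod =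
        g k₀ * (D (g k) * ((M.erase k).map g).prod) := by
      intro k hk
      rcases eq_or_ne k k₀ with rfl | hne
      · rw [Multiset.erase_cons_head]
        conv_lhs => rw [← Multiset.cons_erase hk]
        rw [Multiset.map_cons, Multiset.prod_cons]
        ring
      · rw [Multiset.erase_cons_tail M (Ne.symm hne), Multiset.map_cons, Multiset.prod_cons]
        ring
    rw [Multiset.map_congr rfl hterm, Multiset.sum_map_mul_left]
    ring

/-- `(∂_a - ∂_b) p_k = k · (y_a^{k-1} - y_b^{k-1})`. [folklore] -/
theorem delta_psum [Fintype σ] [DecidableEq σ] (a b : σ) (k : ℕ) :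
    pderiv a (psum σ ℂ k) - pderiv b (psum σ ℂ k) =
      (k : MvPolynomial σ ℂ) * (X a ^ (k - 1) - X b ^ (k - 1)) := by
  have h : ∀ v : σ, pderiv v (psum σ ℂ k) = (k : MvPolynomial σ ℂ) * X v ^ (k - 1) := by
    intro v
    rw [psum, map_sum, Finset.sum_eq_single v]
    · rw [pderiv_pow, pderiv_X_self, mul_one]
    · intro i _ hi; rw [pderiv_pow, pderiv_X_of_ne hi, mul_zero]
    · intro h; exact absurd (Finset.mem_univ v) h
  rw [h a, h b]
  ring

/-- One difference-derivative step on a power-sum product: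
`(∂_a - ∂_b) Π_{k∈μ} p_k = Σ_{k∈μ} k (y_a^{k-1} - y_b^{k-1}) · Π_{μ.erase k} p`. [folklore] -/
theorem delta_psumProd [Fintype σ] [DecidableEq σ] (a b : σ) (μ : Multiset ℕ) :
    pderiv a ((μ.map (psum σ ℂ)).prod) - pderiv b ((μ.map (psum σ ℂ)).prod) =
      (μ.map fun k : ℕ => ((k : ℕ) : MvPolynomial σ ℂ) * (X a ^ (k - 1) - X b ^ (k - 1)) *
        ((μ.erase k).map (psum σ ℂ)).prod).sum := by
  have h := derivation_multiset_prod (σ := σ) (pderiv a - pderiv b) (psum σ ℂ) μ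
  simp only [Derivation.sub_apply] at h
  rw [h]
  refine congrArg _ (Multiset.map_congr rfl fun k _ => ?_)
  rw [delta_psum]

/-! ### (N1) Narrow products are killed -/

/-- **(N1)** If the `2j` variables `a i, b i` are pairwise distinct and the multiset `μ` of positive integers has
fewer than `j` parts `≥ 2`, then `Π_i (∂_{a i} - ∂_{b i}) (Π_{k∈μ} p_k) = 0`. [folklore] -/
theorem deltaFold_psumProd_eq_zero_of_narrow [Fintype σ] [DecidableEq σ] :
    ∀ (j : ℕ) (a b : Fin j → σ), Function.Injective a → Function.Injective b → (∀ i i', a i ≠ b i') →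
      ∀ μ : Multiset ℕ, (∀ k ∈ μ, 0 < k) → (μ.filter fun k => 2 ≤ k).card < j →
        List.foldl (fun (q : MvPolynomial σ ℂ) i => pderiv (a i) q - pderiv (b i) q)
          ((μ.map (psum σ ℂ)).prod) (List.finRange j) = 0 := by
  intro j
  induction j with
  | zero => intro a b _ _ _ μ _ h; exact absurd h (Nat.not_lt_zero _)
  | succ j ih =>
    intro a b ha hb hab μ hμ hcard
    rw [deltaFold_succ, delta_psumProd, deltaFoldList_multiset_sum, Multiset.map_map]
    refine Multiset.sum_eq_zero fun x hx => ?_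
    obtain ⟨k, hk, rfl⟩ := Multiset.mem_map.1 hx
    simp only [Function.comp_apply]
    -- the prefactor `k (y_{a0}^{k-1} - y_{b0}^{k-1})` is killed by the remaining derivations
    have hkill_a : ∀ i : Fin j, pderiv (a i.succ)
        ((k : MvPolynomial σ ℂ) * (X (a 0) ^ (k - 1) - X (b 0) ^ (k - 1))) = 0 := by
      intro i
      have h1 : a i.succ ≠ a 0 := fun h => Fin.succ_ne_zero i (ha h)
      have h2 : a i.succ ≠ b 0 := hab _ _
      simp [pderiv_X_of_ne (Ne.symm h1), pderiv_X_of_ne (Ne.symm h2)]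
    have hkill_b : ∀ i : Fin j, pderiv (b i.succ)
        ((k : MvPolynomial σ ℂ) * (X (a 0) ^ (k - 1) - X (b 0) ^ (k - 1))) = 0 := by
      intro i
      have h1 : b i.succ ≠ a 0 := fun h => hab 0 i.succ h.symm
      have h2 : b i.succ ≠ b 0 := fun h => Fin.succ_ne_zero i (hb h)
      simp [pderiv_X_of_ne (Ne.symm h1), pderiv_X_of_ne (Ne.symm h2)]
    rw [deltaFoldList_mul_of_killed _ _ _ hkill_a hkill_b]
    rcases Nat.lt_or_ge k 2 with hk2 | hk2
    · -- a unit part: the prefactor vanishes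
      have hk1 : k = 1 := by have := hμ k hk; omega
      subst hk1
      simp
    · -- a part `≥ 2`: the remaining product is narrow for `j`
      have hnarrow : ((μ.erase k).filter fun k => 2 ≤ k).card < j := by
        have h := Multiset.filter_cons_of_pos (p := fun k => 2 ≤ k) (μ.erase k) (a := k) hk2
        rw [Multiset.cons_erase hk] at h
        rw [h, Multiset.card_cons] at hcard
        omega
      rw [ih (fun i => a i.succ) (fun i => b i.succ) (ha.comp (Fin.succ_injective j))
        (hb.comp (Fin.succ_injective j)) (fun i i' => hab _ _) (μ.erase k)
        (fun k' hk' => hμ k' (Multiset.mem_of_mem_erase hk')) hnarrow, mul_zero]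

end Summit.ValiantsHypothesis.ValiantsHypothesis.Theorems.SmlDeltaCalculus
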